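import Mathlib
import HarnessLib
import HarnessLib.Audit
import Summits.RiemannHypothesis.Statement
import Literature.Barriers.RiemannHypothesis.TuranPartialSums
import HarnessLib.Audit.Status.Attr

/-!
Route: NbGhostOfThePole

# Route NbGhostOfThePole — Ghost of the pole — the truncated Nyman–Beurling distances of the
sections ζ_M tend to the trivial value 2π as M → ∞ (the zero of ζ_M shadowing s = 1), with the exact
one-term law at every M

Column LI/NB of the RH ladder, rung L-P(P2′) «NB TRUNCATION BARRIER» sharpened to its LIMIT LAW
(D-0145 ideator seat rh-idea-3, technique card
RESTRICT-THEN-TIGHTEN + extremal-example mining; own line; RH-FREE, RECORD / BARRIER class, 0 summit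
credit; no idea card realised). B21 (route
NbTruncationBarrier, kernel NbTruncation.lean f605594abd5d29dc) says the truncated Nyman–Beurling
statement FIN_M is false for every M ≥ 3: inside the
Báez-Duarte distance ∫ |1 − ζ_M(½+it)·A_a(½+it)|² dt/(¼+t²) the section ζ_M = Σ_(n≤M) n^(−s) cannot
be mollified to 0. X = THE LAW «GHOST OF THE POLE»: (i) for every
ε > 0 there is M₀ such that for all M ≥ M₀, all lengths N and all coefficient vectors a, ∫ |1 −
ζ_M(½+it)·A_a(½+it)|² dt/(¼+t²) ≥ 2π − ε — and 2π = ∫ dt/(¼+t²) is the value of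
the ZERO mollifier, so lim_(M→∞) inf_(N,a) = 2π: for large M the sections are asymptotically
useless, no Dirichlet polynomial does anything against them;
(ii) at every finite M ≥ 1 the best one-term mollifier A = a is EXACTLY 2π(1 − H_M²/(2M − H_M)) at a
= H_M/(2M − H_M), H_M = Σ_(n≤M) 1/n, so the deficiency
2π − inf is at least ~π(log M)²/M and the ε in (i) cannot be dropped at any M. Mechanism of (i): ζ_M
has a zero ρ_M → 1 — the GHOST OF THE POLE of ζ:
(s − 1)ζ_M(s) ≈ (s − 1)ζ(s) − M^(1−s) ≈ 1 − M^(1−s) near s₀ = 1 + 2πi/log M, and Rouché on |s − s₀|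
< 1/(2 log M) (the tree's `exists_zero_of_norm_sub_expModel_lt`,
model C(1 − e^(−Λ(s−s₀))) with C = 1, Λ = log M) puts a zero there for all large M; the SHARP
reproducing-kernel floor 2π(2Re ρ − 1)/|ρ|² (Nikolski; the
ζ_M-port of the tree's `NbSharpFloor`, no pole hence no Blaschke factor) then tends to 2π·1/1 = 2π.
Restrict (ζ ↦ sections, B21's setting) then tighten
(«floor > 0» ↦ «floor → the trivial value, with the exact one-term law below it»). No summit is
proved by this line; nothing here bears on the truth of RH.
Lean: `(∀ ε : ℝ, 0 < ε → ∃ M₀ : ℕ, ∀ M : ℕ, M₀ ≤ M → ∀ (N : ℕ) (a : Fin N → ℂ), ENNReal.ofReal (2 *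
Real.pi - ε) ≤ ∫⁻ t : ℝ, ENNReal.ofReal (‖1 - Literature.Barriers.RiemannHypothesis.zetaPartialSum M
(1 / 2 + t * Complex.I) * ∑ n : Fin N, a n * ((n : ℂ) + 1) ^ (-(1 / 2 + t * Complex.I))‖ ^ 2 / (1 /
4 + t ^ 2))) ∧ (∀ M : ℕ, 1 ≤ M → ∃ a : Fin 1 → ℂ, ∫⁻ t : ℝ, ENNReal.ofReal (‖1 -
Literature.Barriers.RiemannHypothesis.zetaPartialSum M (1 / 2 + t * Complex.I) * ∑ n : Fin 1, a n *
((n : ℂ) + 1) ^ (-(1 / 2 + t * Complex.I))‖ ^ 2 / (1 / 4 + t ^ 2)) = ENNReal.ofReal (2 * Real.pi *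
(1 - (∑ n ∈ Finset.Icc 1 M, (1 : ℝ) / n) ^ 2 / (2 * M - ∑ n ∈ Finset.Icc 1 M, (1 : ℝ) / n))))`

## Assembly
The Assembly item is PROVED in the planner's folder (Sketch4.lean `assembly_holds`, ≈ 70 lines, farm
rc 0; a typer lands it verbatim): given ε, take δ = min(1/8, ε/(8π)); from
GhostZeroDisc take M₀ and enlarge it to M ≥ max(M₀, 2, ⌈exp((2π+1)/δ)⌉) so that (2π + 1)/log M ≤ δ;
the disc zero then has |ρ − 1| ≤ 1/(2 log M) + 2π/log M
< δ, hence Re ρ > 1 − δ ≥ 7/8 > ½ and |ρ| ≤ 1 + δ, and the sharp floor satisfies 2π(2Re ρ − 1)/|ρ|²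
≥ 2π(1 − 2δ)/(1 + δ)² ≥ 2π(1 − 4δ) ≥ 2π − ε;
`ENNReal.ofReal_le_ofReal` and SharpZeroFloor finish (i); (ii) is TrivialGainLaw verbatim. The
deciding theorem `closes (h2 : GhostZeroDisc)
(h3 : TrivialGainLaw) (h9 : SharpZeroFloor) (hA : Assembly) : GhostOfThePoleLaw := hA h2 h3 h9` is
glue.lean (every binder consumed).

Rationale: WHY THIS LINE. Mechanism: two known engines pointed at a new target. (1) The zero of ζ_M near 1 +
2πik/log M is the partial sum's memory of the pole of ζ (Euler–Maclaurin:
ζ_M(s) = ζ(s) − M^(1−s)/(s−1) + O(M^(−σ)); the k = ±1 zeros converge to 1 as M → ∞, Re ρ_M = 1 −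
O(1/log³M), Im ρ_M = (2π/log M)(1 − γ/log M + …)); the
tree already holds the exact Rouché step needed (Montgomery1983 §4 as
`TuranPartialSumsMontgomeryRouche.exists_zero_of_norm_sub_expModel_lt`: margin ‖C‖/8
on the closed disc of radius 1/(2Λ)). (2) In H²(Re s > ½) with the critical-line measure, G = (1 −
ζ_M A)/s takes the value 1/ρ at every zero ρ of ζ_M
whatever A is, so ‖G‖² ≥ |G(ρ)|²/k_ρ(ρ) = (2Re ρ − 1)/|ρ|² (reproducing kernel k_ρ(s) = 1/(s + ρ̄ −
1)); the tree proves this shape for ζ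
(`Splittings.NbSharpFloor.nbIntegrand_sharpFloor_of_zero`, Nikolski1995 Thm 0.1, via the contour
lemma `ofReal_norm_le_lintegral_line` and R → ∞) and the
lossy form for ζ_M (`NbTruncationA.truncIntegrand_floor_of_zero`, constant 4π(Re ρ −
½)²/(|ρ|²|ρ+1|²), which would only give the limit π/4). Put together:
floor(ρ_M) → 2π = everything. (3) The tighten side is the exact extremal example at N = 1 (pairing ∫
m^(−½−it) n^(−½+it) dt/(¼+t²) = 2π/max(m,n):
⟨1, ζ_M⟩ = 2πH_M, ‖ζ_M‖² = 2π(2M − H_M)). Imported areas: function theory of Dirichlet polynomials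
(Turan1948, Montgomery1983, GonekLedoan2010, Spira1968,
PlattTrudgian2016 — zeros of sections) and model-space / reproducing-kernel geometry (Nikolski1995,
Burnol2002, BaezDuarte2003). What it does that the
listed routes do not: NbTruncationBarrier decides FIN_M qualitatively (floors positive via SOME zero
right of ½, for M ≥ 29 a zero with σ > 1 at
uncontrolled height, floor ~ height^(−4)); NbSectionTwoDyadic solves M = 2 exactly;
NymanBeurlingTail / NymanBeurlingRate concern ζ itself. None has the
LIMIT LAW in M, the ghost zero, or the sharp section floor; the new lever is «the pole's shadow zero
ρ_M → 1 makes the kernel floor exhaust the whole norm».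
Negatives index (4 entries: ShiftedResolvent ×2, CharacterSums, UniversalFactor) untouched.

RANKED CRUXES. #0 GhostOfThePoleLaw (target) — THE RUNG LEAF «ghost of the pole»: (i) ∀ ε > 0 ∃ M₀ ∀
M ≥ M₀ ∀ N a, 2π − ε ≤ ∫ |1 − ζ_M(½+it)·A_a(½+it)|² dt/(¼+t²) (as ENNReal.ofReal ≤ lintegral); (ii)
∀ M ≥ 1 ∃ a : Fin 1 → ℂ with lintegral = ofReal(2π(1 − H_M²/(2M − H_M))), H_M = Σ_(n ∈ [1,M]) 1/n.
(why it might fail: only through its parts: (i) needs a zero ρ_M → 1 (GhostZeroDisc) and the SHARP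
floor (the lossy tree floor caps at π/4 < 2π); (ii) is an exact identity — a slip in the tail term
|1 − Ma|²/M of the discrete form would change the constant (excluded for M ≤ 10 by exact
arithmetic).) [Montgomery1983, Nikolski1995, BaezDuarte2003]
#2 GhostZeroDisc (crux) — GHOST ZERO IN THE ROUCHÉ DISC: there is M₀ such that for every M ≥ M₀ the
section ζ_M has a zero ρ with |ρ − (1 + 2πi/log M)| < 1/(2 log M). [difficulty: M] (why it might
fail: the Rouché margin 1/8 needs |(s−1)ζ(s) − 1| + |(s−1)·(EM remainder)| < 1/8 on the disc, i.e.
γ(2π+½)/log M < 1/8, log M ≳ 32; numerically the zero is in the disc only from M ≈ 10³ (M = 100: |ρ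
− s₀| = 0.149 > r = 0.109): a small explicit M₀ is false, ∃ M₀ is essential.) [Montgomery1983,
Turan1948, GonekLedoan2010, Spira1968]
#3 TrivialGainLaw (crux) — THE ONE-TERM LAW (extremal example, exact): for every M ≥ 1 the best
constant mollifier gives exactly ∫ |1 − a ζ_M(½+it)|² dt/(¼+t²) = 2π(1 − H_M²/(2M − H_M)) at a =
H_M/(2M − H_M). [difficulty: M] (why it might fail: rests on the pairing identity ∫ m^(−½−it)
n^(−½+it) dt/(¼+t²) = 2π/max(m,n) (Poisson kernel) and the expansion ⟨1,ζ_M⟩ = 2πH_M, ‖ζ_M‖² = 2π(2M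
− H_M); an error there shifts the constant; as an ENNReal equality it also needs the integrand
integrable (bounded numerator: fine). Verified exactly M ≤ 10.) [BaezDuarte2003, Burnol2002,
Beurling1955]
#9 SharpZeroFloor (support) — SHARP SECTION FLOOR (port of the tree's Nikolski floor `NbSharpFloor`
from ζ to ζ_M; no pole, so no Blaschke factor (s−1)/(s+1)): if ζ_M(ρ) = 0 with Re ρ > ½ then 2π(2Re
ρ − 1)/|ρ|² ≤ ∫ |1 − ζ_M(½+it)·A_a(½+it)|² dt/(¼+t²) for all N, a (tight: at M = 0, ρ = 1 both sides
are 2π). [Nikolski1995, Burnol2002]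

TWO-LAYER PLAN. GhostZeroDisc ⇐ StubModel (the Rouché margin on the closed disc for M ≥ M₀:
Euler–Maclaurin for ζ_M at σ ≈ 1 plus (s−1)ζ(s) = 1 + O(|s−1|) from the
removable singularity — Mathlib `riemannZeta_residue_one`) → StubRouche (apply
`exists_zero_of_norm_sub_expModel_lt` with C = 1, Λ = log M to the entire
F(s) = (s−1)ζ_M(s); the factor s − 1 has no zero in the disc since |1 − s₀| = 2π/log M > 1/(2 log
M)) — skeleton bc4/GhostZeroDisc_birth.lean, 2 stubs,
`GhostZeroDisc_of` kernel-checked. TrivialGainLaw ⇐ StubPoisson (= item PoissonKernelFourier of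
route NbSectionTwoDyadic, verbatim) → StubQuadratic
(I_M(1,a) = ofReal(2π(1 − 2Re a·H_M + |a|²(2M − H_M)))) — skeleton bc4/TrivialGainLaw_birth.lean,
`TrivialGainLaw_of` kernel-checked (chooses a and does
the algebra). SharpZeroFloor: port `NbSharpFloorKernel`/`NbSharpFloor` with test function (1 − ζ_M
A)R²/(s(s+R)²) and R → ∞. Glued splits filed only if a
prover asks.

KILL CRITERIA. GhostZeroDisc dies if for infinitely many M the disc |s − (1 + 2πi/log M)| < 1/(2 log
M) is zero-free (a certified zero count / argument-principle box for a
lacunary sequence of M would do it; numerics say the zero is inside from M ≈ 10³ and the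
offset/radius ratio is 4πγ/log M → 0). SharpZeroFloor dies on any
(M, ρ, N, a) with lintegral < 2π(2Re ρ − 1)/|ρ|² (it is tight at M = 0, ρ = 1, so any larger
constant IS false). TrivialGainLaw dies on one M where exact
arithmetic of the one-term quadratic form disagrees (M ≤ 10 checked). The whole line is refuted by a
certified sequence M_j → ∞ with inf_(N,a) I_(M_j) ≤ 2π − c,
c > 0 fixed — which the model-space bound already excludes given the ghost zeros. Close superseded
if lane (xv-V) lands the limit law itself.

NOT DECOMPOSED YET. The RATE: numerics give 2π − inf_(N,a) I_M ≈ 2π·(1.0–1.25)(log M)²/M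
(model-space bound from the whole ghost family ρ_(M,±k) below, small-N scan above),
between the provable one-term deficiency 2πH_M²/(2M − H_M) and the single-zero bound O(1/log²M); the
conjectured law «deficiency ≍ (log M)²/M» needs ALL
zeros of ζ_M near σ = 1 with |Im| ≲ 1 and a Gram-matrix (Malmquist–Takenaka) estimate — not an item.
Nothing about ζ itself, d_N for ζ, or RH.

CHEAPEST FALSIFIER. RUN (folder data4/, pure Python): (a) ghost.py — Newton from 1 + 2πik/log M, M =
4 … 3·10⁴: a zero of ζ_M with Re > ½ near 1 + 2πi/log M for EVERY M
(10³: 0.99135 + 0.84053i; 10⁴: 0.99610 + 0.64236i), inside the Rouché disc for M ≥ 10³ (0.0696 <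
0.0724; 0.040 < 0.054) and NOT at M = 100 (0.149 > 0.109) —
hence ∃ M₀; sharp single-zero floor (2Re ρ − 1)/|ρ|² = 0.132, 0.391, 0.582, 0.706, 0.749 for M = 10,
10², 10³, 10⁴, 3·10⁴ (→ 1; tree floor → 1/8 only).
(b) Exact one-term law, M ≤ 10, against the exact quadratic-form engine data/dMN_exact.py: 0, 1/10,
29/150, 227/852, 9011/27780, … all EQUAL. (c) SANDWICH:
model-space bound from ≈ 50 ghost zeros ±k (proj_many.py) vs least-squares scan N ≤ 96 (dscan.py):
inf (1/2π)I_M ∈ [0.252, 0.282] (M = 10), [0.525, 0.561]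
(30), [0.749, 0.776] (100), [0.873, 0.890] (300), [0.942, 0.953] (1000) → 1. In Lean: the M = 1
instance of TrivialGainLaw is kernel-checked (bc4/rung4.lean).
Instrument row that would refute the key lemma: lane (xv-V)'s certified zero boxes for ζ_M
(`TuranPartialSumsRun*` kernel certificates): a certified
zero-free disc |s − (1 + 2πi/log M)| < 1/(2 log M) for large M kills GhostZeroDisc.

NUMBERS. Ghost zeros ρ_M (k = 1): M = 4: 0.6260 + 3.1271i; 6: 0.7676 + 2.6290i; 10: 0.8623 +
2.1802i; 30: 0.9447 + 1.5845i; 100: 0.9744 + 1.2158i; 300: 0.9855 + 1.0023i;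
10³: 0.99135 + 0.84053i; 3·10³: 0.99424 + 0.73267i; 10⁴: 0.99610 + 0.64236i; 3·10⁴: 0.99716 +
0.57744i (2π/log M = 4.53, 3.51, 2.73, 1.85, 1.36, 1.10,
0.910, 0.785, 0.682, 0.610). inf_(N ≤ 96)(1/2π)I_M (least squares, floats): M = 10: 0.2819; 30:
0.5611; 100: 0.7762; 300: 0.8900; 1000: 0.9530; exact M ≤ 10
(earlier data): M = 3: 0.030 (N = 128), 4: 0.068, 5: 0.118, 6: 0.162 (N = 32), 8: 0.244, 10: 0.299
(N = 16). One-term law (1/2π)I_M(1,a*) = 1 − H_M²/(2M − H_M):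
0, 1/10, 29/150, 227/852, 9011/27780, 1419/3820, … ; 0.9719 at M = 10³. Deficiency × M/(log M)²:
scan 1.35, 1.14, 1.055, 1.014, 0.985 (M = 10 … 10³);
model-space bound 1.41, 1.23, 1.18, 1.17, 1.22 — conjecture: deficiency ≍ (log M)²/M.

DEFINITION REQUESTS. None: everything is stated inline over
`Literature.Barriers.RiemannHypothesis.zetaPartialSum`, `Real.log`, Finset sums and the lintegral;
the rung
needs a gate-side alt_closer registration (ASK to director-rh / gate5), not a definition.

Novelty: Searches (2026-08-27 ~22:10Z): lit search --hybrid "zeros of partial sums of the Riemann zeta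
function near the line sigma = 1, 1 + 2 pi i k / log N" (8 docs: MV2007 pp 353/206/307
(bibliography, no statement), Titchmarsh pp 36/153, noise); lit search "zeros partial sums zeta
Borwein Ferguson" (6 docs: [corpus:paper:arxiv-0807.0019 p2] GonekLedoan2010 Thm 1 = zero strip α <
σ < β, no zeros σ ≥ 1 + 2 log log X/log X (Turán), finitely many beyond (4/π − 1 + ε) log log X/log
X (Montgomery) — the ghost zero family at height ≍ 1/log X is not isolated there;
[corpus:paper:arxiv-1507.01340] PlattTrudgian2016; [corpus:paper:arxiv-1807.11093] RoyVatwani2019;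
[corpus:paper:arxiv-0902.0923] Balazard–Velásquez Castañón on inf Re of zeros); lit vsearch
"<partial sum has a zero close to 1 + 2πi/log N approximating the pole>" (8 books, all generic:
MV2007 p306, Graham–Kolesnik p15, Bateman–Diamond, Huxley, Ivić — no hit); lit galaxy search "zeros
of partial sums|Zeros of partial sums|…" --star all (18 rows: [galaxy:panama:286268160213021]
Edrei–Saff–Varga «Zeros of Sections of Power Series» (power series, Szegő curves — the analogue
phenomenon for sections of e^z, not Dirichlet sections), rest noise) and "sections of the zeta|Zeros
of sections|zeros of the partial sum|truncated zeta function" --star all (20 rows, same + noise);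
earlier NB searches of this seat (hybrid "Nyman Beurling Baez-Duarte distance d_N …", galaxy
"Nyman-Beurling|Báez-Duarte|…" --star all: LandreauRichard2002, Burnol 2  [refs: paper:arxiv-0807.0019, paper:arxiv-1507.01340, paper:arxiv-1807.11093, paper:arxiv-0902.0923, GonekLedoan2010, PlattTrudgian2016, RoyVatwani2019, LandreauRichard2002, Montgomery1983, Turan1948, Spira1968, Nikolski1995]

Barriers (technique_class: restrict-then-tighten, Rouche ghost zero, kernel floor): - technique_class: restrict-then-tighten, Rouche ghost zero, kernel floor
- Literature.Barriers.RiemannHypothesis.TuranPartialSums: outside, and used as a resource — the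
barrier closes Turán's route THROUGH ZERO-FREE sections (ζ_N has zeros with σ > 1 for N ≥ 29,
`TuranPartialSums_holds`); this line needs zeros of the sections, not their absence, and adds the
low zero near 1 + 2πi/log M that the barrier's certificates (σ > 1, large height) do not provide;
nothing is inferred about ζ or RH.
- Literature.Barriers.RiemannHypothesis.NymanBeurlingObstructions: outside — the entry (divergence
of the natural approximations, C/√log N floors for χ against the FULL ζ, BaezDuarte2000 /
Burnol2002) concerns ζ; here the approximated object is the section ζ_M, whose floors come from its
own off-line zeros and tend to the trivial value; no statement about d_N(ζ) is made or used.
- Literature.Barriers.RiemannHypothesis.MollifierLimitations: outside — no mollification of ζ, no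
mean-value asymptotics, no inference to zeros of ζ; the «mollifier» multiplies a Dirichlet
polynomial ζ_M and the result is a lower bound for that finite problem.
- Literature.Barriers.RiemannHypothesis.BohrDenseValues: not this class — no value-distribution /
universality input; the zero is produced by Rouché against an explicit exponential model at an
explicit point, for each single M.
- Literature.Barriers.RiemannHypothesis.LittlewoodOscillation: not this class — no prime-counting
error term; the only oscillating qua

sub-problem: RiemannHypothesis · status: draft · opened planner-rh-idea-3-g0-0 2026-08-27T21:39:40Z · rev 0 · ledger route-RiemannHypothesis-NbGhostOfThePole
GENERATED by the gate from the ledger (D-0016/17). Provers cite these decls: `theorem foo : Summit.RiemannHypothesis.RiemannHypothesis.Theses.NbGhostOfThePole.<Decl> := …` in Summits/RiemannHypothesis/RiemannHypothesis/Theorems/<Name>.lean.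
-/

namespace Summit.RiemannHypothesis.RiemannHypothesis.Theses.NbGhostOfThePole

open scoped BigOperators Topology Manifold Classical MeasureTheory ProbabilityTheory Matrix InnerProductSpace ComplexConjugate ContinuousMap
open Filter Set Function TopologicalSpace MeasureTheory

attribute [summit_statement] _root_.Summit.RiemannHypothesis

open Summit

/-- item stmt-RiemannHypothesis-22974 · target · rank 0 · open · by planner
why it might fail: only through its parts: (i) needs a zero ρ_M → 1 (GhostZeroDisc) and the SHARP floor (the lossy tree floor caps at π/4 < 2π); (ii) is an exact identity — a slip in the tail term |1 − Ma|²/M of the discrete form would change the constant (excluded for M ≤ 10 by exact arithmetic).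
sources: Montgomery1983, Nikolski1995, BaezDuarte2003
[target] THE RUNG LEAF «ghost of the pole»: (i) ∀ ε > 0 ∃ M₀ ∀ M ≥ M₀ ∀ N a, 2π − ε ≤ ∫ |1 −
ζ_M(½+it)·A_a(½+it)|² dt/(¼+t²) (as ENNReal.ofReal ≤ lintegral); (ii) ∀ M ≥ 1 ∃ a : Fin 1 → ℂ with
lintegral = ofReal(2π(1 − H_M²/(2M − H_M))), H_M = Σ_(n ∈ [1,M]) 1/n. -/
@[route_item "route-RiemannHypothesis-NbGhostOfThePole"]
def GhostOfThePoleLaw : Prop :=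
  (∀ ε : ℝ, 0 < ε → ∃ M₀ : ℕ, ∀ M : ℕ, M₀ ≤ M → ∀ (N : ℕ) (a : Fin N → ℂ), ENNReal.ofReal (2 * Real.pi - ε) ≤ ∫⁻ t : ℝ, ENNReal.ofReal (‖1 - Literature.Barriers.RiemannHypothesis.zetaPartialSum M (1 / 2 + t * Complex.I) * ∑ n : Fin N, a n * ((n : ℂ) + 1) ^ (-(1 / 2 + t * Complex.I))‖ ^ 2 / (1 / 4 + t ^ 2))) ∧ (∀ M : ℕ, 1 ≤ M → ∃ a : Fin 1 → ℂ, ∫⁻ t : ℝ, ENNReal.ofReal (‖1 - Literature.Barriers.RiemannHypothesis.zetaPartialSum M (1 / 2 + t * Complex.I) * ∑ n : Fin 1, a n * ((n : ℂ) + 1) ^ (-(1 / 2 + t * Complex.I))‖ ^ 2 / (1 / 4 + t ^ 2)) = ENNReal.ofReal (2 * Real.pi * (1 - (∑ n ∈ Finset.Icc 1 M, (1 : ℝ) / n) ^ 2 / (2 * M - ∑ n ∈ Finset.Icc 1 M, (1 : ℝ) / n))))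

/-- item stmt-RiemannHypothesis-22975 · crux · rank 2 · closed · proved by Summit.RiemannHypothesis.RiemannHypothesis.Theorems.NbGhostOfThePole.GhostZeroDisc_proof (prover) · by planner
why it might fail: the Rouché margin 1/8 needs |(s−1)ζ(s) − 1| + |(s−1)·(EM remainder)| < 1/8 on the disc, i.e. γ(2π+½)/log M < 1/8, log M ≳ 32; numerically the zero is in the disc only from M ≈ 10³ (M = 100: |ρ − s₀| = 0.149 > r = 0.109): a small explicit M₀ is false, ∃ M₀ is essential.
sources: Montgomery1983, Turan1948, GonekLedoan2010, Spira1968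
[crux] GHOST ZERO IN THE ROUCHÉ DISC: there is M₀ such that for every M ≥ M₀ the section ζ_M has a
zero ρ with |ρ − (1 + 2πi/log M)| < 1/(2 log M). [difficulty: M] -/
@[route_item "route-RiemannHypothesis-NbGhostOfThePole", crux]
def GhostZeroDisc : Prop :=
  ∃ M₀ : ℕ, ∀ M : ℕ, M₀ ≤ M → ∃ ρ : ℂ, Literature.Barriers.RiemannHypothesis.zetaPartialSum M ρ = 0 ∧ ‖ρ - (1 + 2 * Real.pi / Real.log M * Complex.I)‖ < 1 / (2 * Real.log M)

-- `GhostZeroDisc` holds: proved by `Summit.RiemannHypothesis.RiemannHypothesis.Theorems.NbGhostOfThePole.GhostZeroDisc_proof` (its module imports this route file, so no `_holds` link can be stated here).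

/-- item stmt-RiemannHypothesis-22976 · crux · rank 3 · closed · proved by Summit.RiemannHypothesis.RiemannHypothesis.Theorems.NbGhostOfThePole.TrivialGainLaw_proof (prover) · by planner
why it might fail: rests on the pairing identity ∫ m^(−½−it) n^(−½+it) dt/(¼+t²) = 2π/max(m,n) (Poisson kernel) and the expansion ⟨1,ζ_M⟩ = 2πH_M, ‖ζ_M‖² = 2π(2M − H_M); an error there shifts the constant; as an ENNReal equality it also needs the integrand integrable (bounded numerator: fine). Verified exactly M ≤ 10.
sources: BaezDuarte2003, Burnol2002, Beurling1955
[crux] THE ONE-TERM LAW (extremal example, exact): for every M ≥ 1 the best constant mollifier gives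
exactly ∫ |1 − a ζ_M(½+it)|² dt/(¼+t²) = 2π(1 − H_M²/(2M − H_M)) at a = H_M/(2M − H_M). [difficulty:
M] -/
@[route_item "route-RiemannHypothesis-NbGhostOfThePole", crux]
def TrivialGainLaw : Prop :=
  ∀ M : ℕ, 1 ≤ M → ∃ a : Fin 1 → ℂ, ∫⁻ t : ℝ, ENNReal.ofReal (‖1 - Literature.Barriers.RiemannHypothesis.zetaPartialSum M (1 / 2 + t * Complex.I) * ∑ n : Fin 1, a n * ((n : ℂ) + 1) ^ (-(1 / 2 + t * Complex.I))‖ ^ 2 / (1 / 4 + t ^ 2)) = ENNReal.ofReal (2 * Real.pi * (1 - (∑ n ∈ Finset.Icc 1 M, (1 : ℝ) / n) ^ 2 / (2 * M - ∑ n ∈ Finset.Icc 1 M, (1 : ℝ) / n)))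

-- `TrivialGainLaw` holds: proved by `Summit.RiemannHypothesis.RiemannHypothesis.Theorems.NbGhostOfThePole.TrivialGainLaw_proof` (its module imports this route file, so no `_holds` link can be stated here).

/-- item stmt-RiemannHypothesis-22977 · support · rank 9 · closed · proved by Summit.RiemannHypothesis.RiemannHypothesis.Theorems.NbGhostOfThePole.SharpZeroFloor_proof (prover) · by planner
sources: Nikolski1995, Burnol2002
[support] SHARP SECTION FLOOR (port of the tree's Nikolski floor `NbSharpFloor` from ζ to ζ_M; no
pole, so no Blaschke factor (s−1)/(s+1)): if ζ_M(ρ) = 0 with Re ρ > ½ then 2π(2Re ρ − 1)/|ρ|² ≤ ∫ |1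
− ζ_M(½+it)·A_a(½+it)|² dt/(¼+t²) for all N, a (tight: at M = 0, ρ = 1 both sides are 2π). -/
@[route_item "route-RiemannHypothesis-NbGhostOfThePole", crux]
def SharpZeroFloor : Prop :=
  ∀ (M : ℕ) (ρ : ℂ), Literature.Barriers.RiemannHypothesis.zetaPartialSum M ρ = 0 → 1 / 2 < ρ.re → ∀ (N : ℕ) (a : Fin N → ℂ), ENNReal.ofReal (2 * Real.pi * (2 * ρ.re - 1) / ‖ρ‖ ^ 2) ≤ ∫⁻ t : ℝ, ENNReal.ofReal (‖1 - Literature.Barriers.RiemannHypothesis.zetaPartialSum M (1 / 2 + t * Complex.I) * ∑ n : Fin N, a n * ((n : ℂ) + 1) ^ (-(1 / 2 + t * Complex.I))‖ ^ 2 / (1 / 4 + t ^ 2))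

-- `SharpZeroFloor` holds: proved by `Summit.RiemannHypothesis.RiemannHypothesis.Theorems.NbGhostOfThePole.SharpZeroFloor_proof` (its module imports this route file, so no `_holds` link can be stated here).

/-- item stmt-RiemannHypothesis-22978 · assembly · rank 1 · closed · proved by Summit.RiemannHypothesis.RiemannHypothesis.Theorems.NbGhostOfThePole.assembly_proof (prover) · by planner
sources: Montgomery1983, Nikolski1995
[assembly] GhostZeroDisc → TrivialGainLaw → SharpZeroFloor → GhostOfThePoleLaw (ρ_M → 1 makes the
sharp floor exhaust 2π; proved in folder, `assembly_holds`). -/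
@[route_item "route-RiemannHypothesis-NbGhostOfThePole", crux]
def Assembly : Prop :=
  GhostZeroDisc → TrivialGainLaw → SharpZeroFloor → GhostOfThePoleLaw

-- `Assembly` holds: proved by `Summit.RiemannHypothesis.RiemannHypothesis.Theorems.NbGhostOfThePole.assembly_proof` (its module imports this route file, so no `_holds` link can be stated here).

/-! D-0027 §2.1 — DECIDING THEOREM (planner-authored via `route open/edit --closes-file`; by planner-rh-idea-3-g0-0 2026-08-27T21:39:41Z):
its hypotheses are this route's items and its conclusion the sub-problem Statement (glue_lint), and it elaborates with this file. -/

-- glue4.lean — DECIDING THEOREM of route NbGhostOfThePole (D-0027 §2.1; D-0061 rung shape: concludes the RUNG item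
-- `Summit.RiemannHypothesis.RiemannHypothesis.Theses.NbGhostOfThePole.GhostOfThePoleLaw` («ghost of the pole: the sections are
-- asymptotically useless inside the Báez-Duarte distance», RH-FREE, column LI/NB, rung L-P(P2′) limit law; to be LOADED as alt_closer by
-- gate5 on director-rh's ASK) BY NAME.  Hypotheses = the two cruxes + the sharp-floor support + the Assembly item (PROVED in the planner's
-- folder: Sketch4.lean `assembly_holds`, ≈ 70 lines, farm rc 0 — a typer can land it verbatim).  Every binder is consumed (BC1: 4 binders;
-- BC6: declared 5 = target + 2 cruxes + support + assembly, all in cone).  No summit is proved by this line.  Nothing here bears on the truth of RH.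
@[closes "route-RiemannHypothesis-NbGhostOfThePole"] theorem closes (h2 : GhostZeroDisc) (h3 : TrivialGainLaw) (h9 : SharpZeroFloor) (hA : Assembly) : GhostOfThePoleLaw :=
  hA h2 h3 h9

end Summit.RiemannHypothesis.RiemannHypothesis.Theses.NbGhostOfThePole
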